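import Mathlib
import Summits.NavierStokesRegularity.NavierStokesRegularity.Theorems.FilamentSkeletonRssSkeletonJ1RLiaThirdDerivative
import Summits.NavierStokesRegularity.NavierStokesRegularity.Theorems.FilamentSkeletonRssSkeletonJ1RLiaSelfWindow

/-!
# Crux `SkeletonJ1R` (stmt-NavierStokesRegularity-23610) · line `streamline_kantorovich_R` · toward stub F2-d (`LiaDefectDerivBL`, v7), tools for the B1′ bookkeeping:
# `x‴` on the closed switched region has no cutoff-derivative term, and the Rosenhead window coefficient at `R = r₀√Γ` is `½ log Γ + O(1/Γ)`

Hand `leafhand-ns-filamentskeletonrs-1` (gen 0), `--supports stmt-NavierStokesRegularity-23610 --as helper`.  MODEL rung, NEGATIVE side of the ladder: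
calculus for a HYPOTHETICAL filament-type blow-up skeleton; nothing here is a claim about Navier–Stokes regularity; the stub and the crux stay OPEN.

Two inputs of the last (Γ-bookkeeping) file of B1′ (plan v6, crux evidence):
* `thirdDerivForm_eq_of_sq_le` — on `‖x_jτ‖² ≤ 2ℓ²` the global third-derivative vector of `…LiaThirdDerivative.hasDerivAt_deriv_deriv_global` equals
  `β⁻¹•(x′×DW·x′ + x″×W)` (`refCutoff = 1`, `χ′ = 0` there), i.e. `x′ ×` it is the `V`-term of hypothesis `hself`;
* `abs_liaWindowCoeff_sqrt_sub_half_log_le` — `|Λ_e(r₀√Γ) − ½ log Γ| ≤ e²/(r₀²Γ)` for `r₀ = e·exp 1/2` (`…LiaSelfWindow.abs_liaWindowCoeff_sub_log_le`).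
-/

set_option linter.dupNamespace false -- `NavierStokesRegularity.NavierStokesRegularity` path/namespace repetition is the tree convention

noncomputable section

namespace Summit.NavierStokesRegularity.NavierStokesRegularity.Theorems.SkeletonJ1RFrame

open Set Function Filter MeasureTheory Real Topology
open Literature.Analysis.FluidPDE Literature.Analysis.Calculus
open Summit.NavierStokesRegularity.NavierStokesRegularity.Theorems.SkeletonJ1RLiaSelf (abs_liaWindowCoeff_sub_log_le)
open scoped InnerProductSpace BigOperators

/-- **On the closed switched region the cutoff-derivative term of `x‴` vanishes**: for `‖y‖² ≤ 2ℓ²` (`ℓ ≠ 0`),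
`(b·χ′(1 − (‖y‖²/ℓ² + 1 − 3))·s)•A + (b·φ(y))•B = b•B`. [folklore] -/
theorem thirdDerivForm_eq_of_sq_le {ℓ : ℝ} (hℓ : ℓ ≠ 0) {y : EuclideanSpace ℝ (Fin 3)} (hy : ‖y‖ ^ 2 ≤ 2 * ℓ ^ 2) (b s : ℝ)
    (A B : EuclideanSpace ℝ (Fin 3)) :
    (b * (deriv Real.smoothTransition (1 - (‖y‖ ^ 2 / ℓ ^ 2 + 1 - 2 * (3 / 2 : ℝ))) * s)) • A + (b * refCutoff ℓ y) • B = b • B := by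
  have hℓ2 : 0 < ℓ ^ 2 := by positivity
  have harg : 1 ≤ 1 - (‖y‖ ^ 2 / ℓ ^ 2 + 1 - 2 * (3 / 2 : ℝ)) := by
    have : ‖y‖ ^ 2 / ℓ ^ 2 ≤ 2 := by rw [div_le_iff₀ hℓ2]; linarith
    linarith
  rw [deriv_smoothTransition_of_one_le harg, refCutoff_eq_one hℓ hy, zero_mul, mul_zero, zero_smul, zero_add, mul_one]

/-- **The window coefficient at `R = r₀√Γ`, `r₀ = e·exp 1/2`, is `½ log Γ` up to `e²/(r₀²Γ)`** (`e > 0`, `Γ ≥ 1`). [folklore] -/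
theorem abs_liaWindowCoeff_sqrt_sub_half_log_le {e Γ : ℝ} (he : 0 < e) (hΓ : 1 ≤ Γ) :
    |(Real.arsinh (e * Real.exp 1 / 2 * Real.sqrt Γ / e) - e * Real.exp 1 / 2 * Real.sqrt Γ / Real.sqrt ((e * Real.exp 1 / 2 * Real.sqrt Γ) ^ 2 + e ^ 2)) -
        Real.log Γ / 2| ≤ e ^ 2 / ((e * Real.exp 1 / 2) ^ 2 * Γ) := by
  set r₀ := e * Real.exp 1 / 2 with hr₀
  set R := r₀ * Real.sqrt Γ with hR
  have hΓ0 : 0 < Γ := by linarith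
  have hG1 : 1 ≤ Real.sqrt Γ := by rw [← Real.sqrt_one]; exact Real.sqrt_le_sqrt hΓ
  have hexp : (2:ℝ) < Real.exp 1 := by have := Real.add_one_lt_exp (one_ne_zero (α := ℝ)); linarith
  have hr₀e : e ≤ r₀ := by rw [hr₀]; nlinarith
  have heR : e ≤ R := hr₀e.trans (by rw [hR]; exact le_mul_of_one_le_right (by positivity) hG1)
  have h := abs_liaWindowCoeff_sub_log_le he heR
  have hlog : Real.log (2 * R / e) - 1 = Real.log Γ / 2 := by
    have h2R : 2 * R / e = Real.exp 1 * Real.sqrt Γ := by rw [hR, hr₀]; field_simp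
    rw [h2R, Real.log_mul (Real.exp_pos 1).ne' (by positivity), Real.log_exp, Real.log_sqrt hΓ0.le]; ring
  have hReq : R ^ 2 = r₀ ^ 2 * Γ := by rw [hR, mul_pow, Real.sq_sqrt hΓ0.le]
  rw [← hlog, ← hReq]
  exact h

end Summit.NavierStokesRegularity.NavierStokesRegularity.Theorems.SkeletonJ1RFrame

end
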